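import Summits.Ventures.YMGap.RobustBall.SummableUniqueness
import Summits.Ventures.YMGap.RobustBall.MassGapOnBall
import HarnessLib

/-!
# Venture YMGap, track ROBUST-BALL (tier 2) — exponential clustering and the packaged mass gap for SUMMABLE
# (infinite-range) perturbations of strong-coupling `SU(N)` lattice Yang–Mills on `ℤ^d`

HONEST FRAMING. WHAT THIS IS: a venture file (cell `pub-ymgap`, track Y2 ROBUST-BALL, seat rb-p1), second
half of the TIER-2 MASS-GAP THEOREM (first half, with the loads `a`, `Λ_t` and uniqueness:
`SummableUniqueness.lean`). Under the single weighted ROW CONDITION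
`6(d-1)|β| e^{a} e^{t} √(c v) + e^{a/2} √c Λ_t < 1` it proves: (ii) for every DLR state of the summable
member `N β S_W + W`, clustering of Lipschitz cylinder observables at RATE `t` per lattice unit,
`|cov_μ(F₁, F₂)| ≤ 2(2√N)² n² e^{-t d(Λ₁, Λ₂)} (K₁ K₂ + ‖F₁‖₂ ‖F₂‖₂)` (`perturbed_covariance_decay_S`, lit-1's
`abs_covariance_le_of_summable_exp_dist` with the profile `dist(·, Λ₂)`; Föllmer Cor. (2.14), Künsch 1982);
(iii) with existence (`perturbedGibbsMeasuresS_nonempty`) and uniqueness (i) the packaged statement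
`perturbedMassGapS_SU` — EXACTLY ONE DLR state and the cell's clustering shape with rate `t > 0`;
(iv) the `SU(2)` reading with the sharp pair `(c, v) = (2/3, 8/3)` (`su2_perturbedMassGapS`):
`2(d-1)|β_W| e^{a} e^{t} + e^{a/2} √(2/3) Λ_t < 1`. WHAT IT IS NOT: a lattice strong-coupling theorem;
no claim about the continuum limit, asymptotic-freedom scaling, or the Clay Millennium problem.

## References

* H. Föllmer, LNM 1362 (1988), Ch. I, Cor. (2.14), (2.24).
* H. Künsch, *Decay of correlations under Dobrushin's uniqueness condition and its applications*,
  Comm. Math. Phys. 84 (1982) 207–222.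
* H.-O. Georgii, *Gibbs Measures and Phase Transitions* (2011), Remark 8.26.
-/

noncomputable section

open MeasureTheory Filter Function ProbabilityTheory Real Topology
open scoped NNReal
open Literature.Probability.LatticeModels
open Literature.Probability.LatticeModels.DobrushinMetric
open Literature.MathematicalPhysics.QuantumLattice
open Literature.MathematicalPhysics.QuantumFieldTheory hiding ZdEdge
open Summit.QuantumFields.BalabanUV.InfraRed.StrongCouplingPoincareDoorSUN (oneLinkPoincareSUN_two_sharp)

namespace Summit.Ventures.YMGap.RobustBall

variable {d N : ℕ}

section SUN

variable {W : Potential (ZdEdge d) (Matrix.specialUnitaryGroup (Fin N) ℂ)} {B : Finset (ZdEdge d) → ℝ}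

/-- **(ii) Exponential clustering at rate `t` for the tier-2 member** (Föllmer 1988, Ch. I, Cor. (2.14)
with (2.24); Künsch 1982; lit-1's `abs_covariance_le_of_summable_exp_dist` with the profile
`dist(·, Λ₂)`): under the weighted row condition every DLR state `μ` of the summable member satisfies,
for Lipschitz cylinder observables with supports `|Λᵢ| ≤ n`,
`|cov_μ(F₁, F₂)| ≤ 2(2√N)² n² · e^{-t d(Λ₁, Λ₂)} (K₁ K₂ + ‖F₁‖₂ ‖F₂‖₂)`. -/
theorem perturbed_covariance_decay_S (hd : 1 ≤ d) (hN : 1 ≤ N) {β b c v a Λt t : ℝ}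
    (hc : 0 ≤ c) (hv : 0 ≤ v) (hb : |β| * (2 * ((d : ℝ) - 1)) ≤ b)
    (hP : ∀ B : Matrix (Fin N) (Fin N) ℂ, matrixOpNorm B ≤ b →
      ∀ (ψ : Matrix.specialUnitaryGroup (Fin N) ℂ → ℝ) (M : ℝ), 0 ≤ M →
        (∀ x y, |ψ x - ψ y| ≤ M * suFrobDist x y) →
        Var[ψ; (haarProbability (Matrix.specialUnitaryGroup (Fin N) ℂ)).tilted
          fun g => (N : ℝ) * ((g : Matrix (Fin N) (Fin N) ℂ) * B).trace.re] ≤ c * M ^ 2)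
    (hVB : ∀ B : Matrix (Fin N) (Fin N) ℂ, matrixOpNorm B ≤ b → ∀ Δ : Matrix (Fin N) (Fin N) ℂ,
      Var[fun g : Matrix.specialUnitaryGroup (Fin N) ℂ =>
          (N : ℝ) * ((g : Matrix (Fin N) (Fin N) ℂ) * Δ).trace.re;
        (haarProbability (Matrix.specialUnitaryGroup (Fin N) ℂ)).tilted
          fun g => (N : ℝ) * ((g : Matrix (Fin N) (Fin N) ℂ) * B).trace.re] ≤ v * frobNorm Δ ^ 2)
    (h : IsLinkSummable W B) (hWc : ∀ X, Continuous (W X))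
    (hWdep : ∀ X, DependsOn (W X) (↑X : Set (ZdEdge d)))
    {osc : Finset (ZdEdge d) → ZdEdge d → ℝ} (hosc : ∀ X, Dobrushin.IsOscBound (W X) (osc X))
    (hoscs : ∀ e, Summable fun X : Finset (ZdEdge d) => (if e ∈ X then osc X e else 0))
    (hosca : ∀ e, ∑' X : Finset (ZdEdge d), (if e ∈ X then osc X e else 0) ≤ a)
    {lip : Finset (ZdEdge d) → ZdEdge d → ℝ} (hlip : ∀ X, IsLipBound suFrobDist (W X) (lip X))
    {ℓ : ZdEdge d → ZdEdge d → ℝ}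
    (hlips : ∀ e y, Summable fun X : Finset (ZdEdge d) => (if e ∈ X ∧ y ∈ X then lip X y else 0))
    (hℓ : ∀ e y, y ≠ e → ∑' X : Finset (ZdEdge d), (if e ∈ X ∧ y ∈ X then lip X y else 0) ≤ ℓ e y)
    (ht : 0 ≤ t) (hℓs : ∀ e, Summable fun y => (if y = e then 0 else ℓ e y) * exp (t * ‖e.1 - y.1‖))
    (hℓt : ∀ e, ∑' y, (if y = e then 0 else ℓ e y) * exp (t * ‖e.1 - y.1‖) ≤ Λt)
    (hρ : 6 * ((d : ℝ) - 1) * |β| * (exp a * exp t * Real.sqrt (c * v)) + exp (a / 2) * Real.sqrt c * Λt < 1)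
    (μ : Measure (LGConfig d (Matrix.specialUnitaryGroup (Fin N) ℂ)))
    (hμ : μ ∈ perturbedGibbsMeasuresS (d := d) (fundamentalRep (Fin N)) (N * β) W) (n : ℕ) :
    ∀ (F₁ F₂ : LGConfig d (Matrix.specialUnitaryGroup (Fin N) ℂ) → ℝ) (Λ₁ Λ₂ : Finset (ZdEdge d))
      (K₁ K₂ : ℝ≥0), Λ₁.card ≤ n → Λ₂.card ≤ n → Disjoint Λ₁ Λ₂ →
      IsLipschitzCylinder (fundamentalRep (Fin N)) F₁ Λ₁ K₁ →
      IsLipschitzCylinder (fundamentalRep (Fin N)) F₂ Λ₂ K₂ →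
        |cov[F₁, F₂; μ]| ≤
          (2 * (2 * Real.sqrt N) ^ 2 * (n : ℝ) ^ 2) * exp (-t * setDistEdges Λ₁ Λ₂) *
            ((K₁ : ℝ) * K₂ + Real.sqrt (∫ U, F₁ U ^ 2 ∂μ) * Real.sqrt (∫ U, F₂ U ^ 2 ∂μ)) := by
  classical
  intro F₁ F₂ Λ₁ Λ₂ K₁ K₂ h₁ h₂ _ hF₁ hF₂
  haveI : SecondCountableTopology (Matrix (Fin N) (Fin N) ℂ) :=
    inferInstanceAs (SecondCountableTopology (Fin N → Fin N → ℂ))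
  haveI : SecondCountableTopology (Matrix.specialUnitaryGroup (Fin N) ℂ) :=
    Topology.IsEmbedding.subtypeVal.secondCountableTopology
  have hγ : IsSpecification (perturbedYMS (d := d) (fundamentalRep (Fin N)) (N * β) W) :=
    isSpecification_perturbedYMS _ (continuous_fundamentalRep (Fin N)) _ h hWc hWdep
  have hℓ0 : ∀ x y, y ≠ x → 0 ≤ ℓ x y := fun x y hyx => by
    refine le_trans (tsum_nonneg fun X => ?_) (hℓ x y hyx)
    split_ifs
    · exact (hlip X).nonneg y
    · exact le_rfl
  have hrow := fun x => summable_coeffS_row₀ (β := β) (c := c) (v := v) (a := a) hd hℓ0 ht hℓs hℓt x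
  have hℓs' : ∀ e, Summable fun y => (if y = e then 0 else ℓ e y) := fun e =>
    Summable.of_nonneg_of_le (fun y => by split_ifs with hye; exacts [le_rfl, hℓ0 e y hye])
      (fun y => le_mul_of_one_le_right (by split_ifs with hye; exacts [le_rfl, hℓ0 e y hye])
        (one_le_exp (by positivity))) (hℓs e)
  have hC0 : ∀ x y : ZdEdge d, 0 ≤ (if y = x then 0 else
      (exp a * Real.sqrt (c * v) * |β| * linkInfluence x y + exp (a / 2) * Real.sqrt c * ℓ x y)) :=
    fun x y => by
      split_ifs with hyx
      · exact le_rfl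
      · exact add_nonneg (by positivity) (mul_nonneg (by positivity) (hℓ0 x y hyx))
  have hρ0 : 0 ≤ 6 * ((d : ℝ) - 1) * |β| * (exp a * exp t * Real.sqrt (c * v)) + exp (a / 2) * Real.sqrt c * Λt := by
    have hd0 : 0 < d := hd
    let e₀ : ZdEdge d := (0, ⟨0, hd0⟩)
    exact (tsum_nonneg (hC0 e₀)).trans (hrow e₀).2.2.1
  have hRsqrt : (0 : ℝ) ≤ 2 * Real.sqrt N := by positivity
  have hμ' : IsGibbsMeasure (perturbedYMS (d := d) (fundamentalRep (Fin N)) (N * β) W) μ := hμ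
  haveI := hμ'.isProbabilityMeasure
  have key := abs_covariance_le_of_summable_exp_dist hγ (fun _ _ => suFrobDist_nonneg _ _) suFrobDist_le
    hRsqrt suFrobDist_self hC0 (fun x => (hrow x).1)
    (fun x ω η φ L hφm hφb hL hφL => abs_integral_siteLaw_perturbedYMS_sub_le_tsum₀ hd hN hc hv hb hP hVB
      h hWc hWdep hosc hoscs hosca hlip hlips hℓ hℓs' x ω η φ L hφm hφb hL hφL)
    hμ' hF₁.measurable hF₁.dependsOn hF₁.abs_le
    (hF₁.isLipBound zero_le_one (fun a b => by rw [one_mul]; exact dist_suEntries_le_suFrobDist a b))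
    hF₂.measurable hF₂.dependsOn hF₂.abs_le
    (hF₂.isLipBound zero_le_one (fun a b => by rw [one_mul]; exact dist_suEntries_le_suFrobDist a b))
    hρ0 hρ (fun x y : ZdEdge d => ‖x.1 - y.1‖) (fun _ _ => norm_nonneg _) ht
    (fun x _ => (hrow x).2.1) (fun x _ => (hrow x).2.2.2) (linkSetDist Λ₂) (linkSetDist_nonneg Λ₂)
    (fun y hy => linkSetDist_eq_zero_of_mem hy) (fun x _ y => linkSetDist_le_add_norm Λ₂ x y)
    (m := setDistEdges Λ₁ Λ₂) (fun y hy => setDistEdges_le_linkSetDist hy)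
  have hK₁ : (0 : ℝ) ≤ K₁ := K₁.2
  have hK₂ : (0 : ℝ) ≤ K₂ := K₂.2
  have hn₁ : (Λ₁.card : ℝ) ≤ n := by exact_mod_cast h₁
  have hn₂ : (Λ₂.card : ℝ) ≤ n := by exact_mod_cast h₂
  have hsum₂ : ∑ y ∈ Λ₂, (if y ∈ Λ₂ then 1 * (K₂ : ℝ) else 0) ≤ n * K₂ := by
    rw [Finset.sum_ite_of_true (fun y hy => hy), Finset.sum_const, nsmul_eq_mul, one_mul]
    exact mul_le_mul_of_nonneg_right hn₂ hK₂
  have hsum₁ : ∑ y ∈ Λ₁, (if y ∈ Λ₁ then 1 * (K₁ : ℝ) else 0) ≤ n * K₁ := by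
    rw [Finset.sum_ite_of_true (fun y hy => hy), Finset.sum_const, nsmul_eq_mul, one_mul]
    exact mul_le_mul_of_nonneg_right hn₁ hK₁
  have hs₁0 : 0 ≤ ∑ y ∈ Λ₁, (if y ∈ Λ₁ then 1 * (K₁ : ℝ) else 0) :=
    Finset.sum_nonneg fun y hy => by rw [if_pos hy]; positivity
  calc |cov[F₁, F₂; μ]|
      ≤ 2 * (2 * Real.sqrt N) ^ 2 * (∑ y ∈ Λ₂, (if y ∈ Λ₂ then 1 * (K₂ : ℝ) else 0)) *
          (∑ y ∈ Λ₁, (if y ∈ Λ₁ then 1 * (K₁ : ℝ) else 0)) * exp (-(t * setDistEdges Λ₁ Λ₂)) := key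
    _ ≤ 2 * (2 * Real.sqrt N) ^ 2 * (n * K₂) * (n * K₁) * exp (-(t * setDistEdges Λ₁ Λ₂)) := by
        gcongr
    _ = (2 * (2 * Real.sqrt N) ^ 2 * (n : ℝ) ^ 2) * exp (-t * setDistEdges Λ₁ Λ₂) * ((K₁ : ℝ) * K₂) := by
        rw [neg_mul]; ring
    _ ≤ (2 * (2 * Real.sqrt N) ^ 2 * (n : ℝ) ^ 2) * exp (-t * setDistEdges Λ₁ Λ₂) *
          ((K₁ : ℝ) * K₂ + Real.sqrt (∫ U, F₁ U ^ 2 ∂μ) * Real.sqrt (∫ U, F₂ U ^ 2 ∂μ)) := by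
        gcongr
        exact le_add_of_nonneg_right (by positivity)

/-- **(iii) The packaged tier-2 mass gap**: under the weighted row condition with `t > 0`, the summable
member has EXACTLY ONE DLR state on `ℤ^d` (uniqueness (i) + existence `perturbedGibbsMeasuresS_nonempty`)
and every DLR state clusters exponentially with rate `t` in the cell's shape (ii) — the body of the
cell's `MassGapAt`, for the infinite-range member. -/
theorem perturbedMassGapS_SU (hd : 1 ≤ d) (hN : 1 ≤ N) {β b c v a Λt t : ℝ}
    (hc : 0 ≤ c) (hv : 0 ≤ v) (hb : |β| * (2 * ((d : ℝ) - 1)) ≤ b)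
    (hP : ∀ B : Matrix (Fin N) (Fin N) ℂ, matrixOpNorm B ≤ b →
      ∀ (ψ : Matrix.specialUnitaryGroup (Fin N) ℂ → ℝ) (M : ℝ), 0 ≤ M →
        (∀ x y, |ψ x - ψ y| ≤ M * suFrobDist x y) →
        Var[ψ; (haarProbability (Matrix.specialUnitaryGroup (Fin N) ℂ)).tilted
          fun g => (N : ℝ) * ((g : Matrix (Fin N) (Fin N) ℂ) * B).trace.re] ≤ c * M ^ 2)
    (hVB : ∀ B : Matrix (Fin N) (Fin N) ℂ, matrixOpNorm B ≤ b → ∀ Δ : Matrix (Fin N) (Fin N) ℂ,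
      Var[fun g : Matrix.specialUnitaryGroup (Fin N) ℂ =>
          (N : ℝ) * ((g : Matrix (Fin N) (Fin N) ℂ) * Δ).trace.re;
        (haarProbability (Matrix.specialUnitaryGroup (Fin N) ℂ)).tilted
          fun g => (N : ℝ) * ((g : Matrix (Fin N) (Fin N) ℂ) * B).trace.re] ≤ v * frobNorm Δ ^ 2)
    (h : IsLinkSummable W B) (hWc : ∀ X, Continuous (W X))
    (hWdep : ∀ X, DependsOn (W X) (↑X : Set (ZdEdge d)))
    {osc : Finset (ZdEdge d) → ZdEdge d → ℝ} (hosc : ∀ X, Dobrushin.IsOscBound (W X) (osc X))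
    (hoscs : ∀ e, Summable fun X : Finset (ZdEdge d) => (if e ∈ X then osc X e else 0))
    (hosca : ∀ e, ∑' X : Finset (ZdEdge d), (if e ∈ X then osc X e else 0) ≤ a)
    {lip : Finset (ZdEdge d) → ZdEdge d → ℝ} (hlip : ∀ X, IsLipBound suFrobDist (W X) (lip X))
    {ℓ : ZdEdge d → ZdEdge d → ℝ}
    (hlips : ∀ e y, Summable fun X : Finset (ZdEdge d) => (if e ∈ X ∧ y ∈ X then lip X y else 0))
    (hℓ : ∀ e y, y ≠ e → ∑' X : Finset (ZdEdge d), (if e ∈ X ∧ y ∈ X then lip X y else 0) ≤ ℓ e y)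
    (ht : 0 < t) (hℓs : ∀ e, Summable fun y => (if y = e then 0 else ℓ e y) * exp (t * ‖e.1 - y.1‖))
    (hℓt : ∀ e, ∑' y, (if y = e then 0 else ℓ e y) * exp (t * ‖e.1 - y.1‖) ≤ Λt)
    (hρ : 6 * ((d : ℝ) - 1) * |β| * (exp a * exp t * Real.sqrt (c * v)) + exp (a / 2) * Real.sqrt c * Λt < 1) :
    HasUniqueGibbsMeasure (perturbedYMS (d := d) (fundamentalRep (Fin N)) (N * β) W) ∧
    ∀ μ ∈ perturbedGibbsMeasuresS (d := d) (fundamentalRep (Fin N)) (N * β) W,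
      ∃ c : ℝ, 0 < c ∧ ∀ n : ℕ, ∃ c₁ : ℝ,
        ∀ (F₁ F₂ : LGConfig d (Matrix.specialUnitaryGroup (Fin N) ℂ) → ℝ)
          (Λ₁ Λ₂ : Finset (ZdEdge d)) (K₁ K₂ : ℝ≥0),
          Λ₁.card ≤ n → Λ₂.card ≤ n → Disjoint Λ₁ Λ₂ →
          IsLipschitzCylinder (fundamentalRep (Fin N)) F₁ Λ₁ K₁ →
          IsLipschitzCylinder (fundamentalRep (Fin N)) F₂ Λ₂ K₂ →
            |cov[F₁, F₂; μ]| ≤ c₁ * Real.exp (-c * setDistEdges Λ₁ Λ₂) *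
              ((K₁ : ℝ) * K₂ + Real.sqrt (∫ U, F₁ U ^ 2 ∂μ) * Real.sqrt (∫ U, F₂ U ^ 2 ∂μ)) := by
  haveI : SecondCountableTopology (Matrix (Fin N) (Fin N) ℂ) :=
    inferInstanceAs (SecondCountableTopology (Fin N → Fin N → ℂ))
  haveI : SecondCountableTopology (Matrix.specialUnitaryGroup (Fin N) ℂ) :=
    Topology.IsEmbedding.subtypeVal.secondCountableTopology
  refine ⟨⟨subsingleton_perturbedGibbsMeasuresS_SU hd hN hc hv hb hP hVB h hWc hWdep hosc hoscs hosca hlip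
      hlips hℓ ht.le hℓs hℓt hρ,
    perturbedGibbsMeasuresS_nonempty _ (continuous_fundamentalRep (Fin N)) _ h hWc hWdep⟩, fun μ hμ => ?_⟩
  refine ⟨t, ht, fun n => ⟨2 * (2 * Real.sqrt N) ^ 2 * (n : ℝ) ^ 2, ?_⟩⟩
  intro F₁ F₂ Λ₁ Λ₂ K₁ K₂ h₁ h₂ hdisj hF₁ hF₂
  exact perturbed_covariance_decay_S hd hN hc hv hb hP hVB h hWc hWdep hosc hoscs hosca hlip hlips hℓ ht.le
    hℓs hℓt hρ μ hμ n F₁ F₂ Λ₁ Λ₂ K₁ K₂ h₁ h₂ hdisj hF₁ hF₂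

end SUN

/-! ### The `SU(2)` reading with the sharp one-link pair `(c, v) = (2/3, 8/3)` -/

/-- **Tier-2 mass gap for `SU(2)` on `ℤ^d`**: for a summable link potential with continuous own-link
terms, oscillation load `a`, diagonal-free weighted cross load `Λ_t` (`t > 0`), and Wilson coupling
`β_W` ('t Hooft `β = β_W/4`) with `2(d-1)|β_W| e^{a} e^{t} + e^{a/2} √(2/3) Λ_t < 1`, the member
`2β S_W + W` has exactly one DLR state and rate-`t` clustering (sharp `SU(2)` Poincaré constant `2/3` at
every drift, `oneLinkPoincareSUN_two_sharp`; linear variance `v = c N² = 8/3`, `linVariance_of_poincare`). -/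
theorem su2_perturbedMassGapS (hd : 1 ≤ d) {βW a Λt t : ℝ}
    {W : Potential (ZdEdge d) (Matrix.specialUnitaryGroup (Fin 2) ℂ)} {B : Finset (ZdEdge d) → ℝ}
    (h : IsLinkSummable W B) (hWc : ∀ X, Continuous (W X))
    (hWdep : ∀ X, DependsOn (W X) (↑X : Set (ZdEdge d)))
    {osc : Finset (ZdEdge d) → ZdEdge d → ℝ} (hosc : ∀ X, Dobrushin.IsOscBound (W X) (osc X))
    (hoscs : ∀ e, Summable fun X : Finset (ZdEdge d) => (if e ∈ X then osc X e else 0))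
    (hosca : ∀ e, ∑' X : Finset (ZdEdge d), (if e ∈ X then osc X e else 0) ≤ a)
    {lip : Finset (ZdEdge d) → ZdEdge d → ℝ} (hlip : ∀ X, IsLipBound suFrobDist (W X) (lip X))
    {ℓ : ZdEdge d → ZdEdge d → ℝ}
    (hlips : ∀ e y, Summable fun X : Finset (ZdEdge d) => (if e ∈ X ∧ y ∈ X then lip X y else 0))
    (hℓ : ∀ e y, y ≠ e → ∑' X : Finset (ZdEdge d), (if e ∈ X ∧ y ∈ X then lip X y else 0) ≤ ℓ e y)
    (ht : 0 < t) (hℓs : ∀ e, Summable fun y => (if y = e then 0 else ℓ e y) * exp (t * ‖e.1 - y.1‖))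
    (hℓt : ∀ e, ∑' y, (if y = e then 0 else ℓ e y) * exp (t * ‖e.1 - y.1‖) ≤ Λt)
    (hρ : 2 * ((d : ℝ) - 1) * |βW| * (exp a * exp t) + exp (a / 2) * Real.sqrt (2 / 3) * Λt < 1) :
    HasUniqueGibbsMeasure (perturbedYMS (d := d) (fundamentalRep (Fin 2)) (2 * (βW / 4)) W) ∧
    ∀ μ ∈ perturbedGibbsMeasuresS (d := d) (fundamentalRep (Fin 2)) (2 * (βW / 4)) W,
      ∃ c : ℝ, 0 < c ∧ ∀ n : ℕ, ∃ c₁ : ℝ,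
        ∀ (F₁ F₂ : LGConfig d (Matrix.specialUnitaryGroup (Fin 2) ℂ) → ℝ)
          (Λ₁ Λ₂ : Finset (ZdEdge d)) (K₁ K₂ : ℝ≥0),
          Λ₁.card ≤ n → Λ₂.card ≤ n → Disjoint Λ₁ Λ₂ →
          IsLipschitzCylinder (fundamentalRep (Fin 2)) F₁ Λ₁ K₁ →
          IsLipschitzCylinder (fundamentalRep (Fin 2)) F₂ Λ₂ K₂ →
            |cov[F₁, F₂; μ]| ≤ c₁ * Real.exp (-c * setDistEdges Λ₁ Λ₂) *
              ((K₁ : ℝ) * K₂ + Real.sqrt (∫ U, F₁ U ^ 2 ∂μ) * Real.sqrt (∫ U, F₂ U ^ 2 ∂μ)) := by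
  have hc : (0 : ℝ) ≤ 2 / 3 := by norm_num
  have hP : ∀ B : Matrix (Fin 2) (Fin 2) ℂ, matrixOpNorm B ≤ |βW / 4| * (2 * ((d : ℝ) - 1)) →
      ∀ (ψ : Matrix.specialUnitaryGroup (Fin 2) ℂ → ℝ) (M : ℝ), 0 ≤ M →
        (∀ x y, |ψ x - ψ y| ≤ M * suFrobDist x y) →
        Var[ψ; (haarProbability (Matrix.specialUnitaryGroup (Fin 2) ℂ)).tilted
          fun g => ((2 : ℕ) : ℝ) * ((g : Matrix (Fin 2) (Fin 2) ℂ) * B).trace.re] ≤ 2 / 3 * M ^ 2 :=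
    fun B hB ψ M hM hψ => oneLinkPoincareSUN_two_sharp _ B hB ψ M hM hψ
  have hVB := linVariance_of_poincare (N := 2) hP
  have hv : (0 : ℝ) ≤ 2 / 3 * ((2 : ℕ) : ℝ) ^ 2 := by norm_num
  have hmain := perturbedMassGapS_SU (N := 2) (β := βW / 4) hd (by norm_num) hc hv le_rfl hP hVB h hWc hWdep
    hosc hoscs hosca hlip hlips hℓ ht hℓs hℓt ?_
  · simpa using hmain
  have hsq : Real.sqrt (2 / 3 * (2 / 3 * ((2 : ℕ) : ℝ) ^ 2)) = 4 / 3 := by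
    rw [show (2 / 3 * (2 / 3 * ((2 : ℕ) : ℝ) ^ 2) : ℝ) = (4 / 3) ^ 2 by norm_num,
      Real.sqrt_sq (by norm_num)]
  rw [hsq]
  have e : 6 * ((d : ℝ) - 1) * |βW / 4| * (exp a * exp t * (4 / 3)) =
      2 * ((d : ℝ) - 1) * |βW| * (exp a * exp t) := by
    rw [abs_div, abs_of_pos (by norm_num : (0 : ℝ) < 4)]
    ring
  rw [e]
  exact hρ

end Summit.Ventures.YMGap.RobustBall
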